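import Summits.HodgeConjecture.CorCM.HypLiu418.A3Liu418EpsRigidFaceTypes
import Literature.NumberTheory.Automorphic.Liu2021.Thm418CyclotomicUnitIsLocalNormOdd
import HarnessLib

/-!
# Row III-11b `CyclotomicUnitIsLocalNormOdd` CLOSED BY NAME (cell `hodgecm-mathlib`, III-11 road P6, odd residue characteristic)

The binder `Summit.HodgeConjecture.CorCM.Lines.A3Liu418.CyclotomicUnitIsLocalNormOdd` of A-p19's III-11 face types
(`A3Liu418EpsRigidFaceTypes`, p611602) — «for `μ` conjugate symplectic (of weight one), `σ ∈ Aut(ℂ/M_μ)`, a (non-split) place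
`v ∤ 2` of `F⁺` and `κ ∈ F⁺_v` with `σ ∘ ψ_v = ψ_v(κ ·)`, the unit `κ` is a norm from the place model `F ⊗_{F⁺} F⁺_v`» —
is the tree theorem `Literature.NumberTheory.Automorphic.Liu2021.exists_mul_conjLocal_eq_of_adeleAddCharAt_galoisTwist`
(`Liu2021/Thm418CyclotomicUnitIsLocalNormOdd`, over `Thm418CyclotomicUnitsLocalNorms` = [Liu2021] Thm. 4.18 (3) proof
l. 2272–2279 at `p` odd, PROVED from the tree's L2/L3 and O'Meara's local symbols), which needs neither the weight-one nor the
non-split hypothesis (absorbed).  One theorem, no definition, no named fact.  HC_CM is proved only modulo the 7 printed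
citations until rung 0 closes.
-/

namespace Summit.HodgeConjecture.CorCM.HypLiu418

/-- **Row III-11b closed by name**: `CyclotomicUnitIsLocalNormOdd` holds — the cyclotomic unit of `σ ∈ Aut(ℂ/M_μ)` is a local norm at
every place `v ∤ 2` ([Liu2021] Thm. 4.18 (3), proof l. 2272–2279, `p` odd; tree
`Liu2021.exists_mul_conjLocal_eq_of_adeleAddCharAt_galoisTwist`). [cite: Liu2021, Thm. 4.18 (3), proof l. 2272–2279] -/
theorem cyclotomicUnitIsLocalNormOdd_holds : Summit.HodgeConjecture.CorCM.Lines.A3Liu418.CyclotomicUnitIsLocalNormOdd :=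
  fun F _μ hμ _ σ hσ v h2 _ κ hκ =>
    Literature.NumberTheory.Automorphic.Liu2021.exists_mul_conjLocal_eq_of_adeleAddCharAt_galoisTwist
      (L := (F : Type)) hμ σ hσ v h2 κ hκ

end Summit.HodgeConjecture.CorCM.HypLiu418
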